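import Summits.MatrixMultiplication.OmegaCensus.STPP222IcosetRankFourBits
import Summits.MatrixMultiplication.OmegaCensus.STPP222IcosetRankFourCanon

/-!
# ω-census, icoset class at 2-rank four: the REDUCTION — engine chunks ⇒ no icoset `(2,2,2)^K` family in `(ZMod 2)⁴ × ZMod n`

HONEST FRAMING (pub-omega census; verbatim): lottery ticket; floor = certified bounds/negative ranges.
Census STRUCTURE bookkeeping (Q7, the involution-coset class), nothing about `ω`.

**`Icoset.not_exists_r4_of_classOk`.**  If the kernel engine accepts every sorted code class — `IcosetW.classOk n (K+1) U (0 :: C) = true`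
for every sorted `C` of length `K` with entries `< n²` — where `U` is a list of units of `ZMod n` closed under products and `K + 1 ≤ 8`,
then NO involution-coset `(2,2,2)^{K+1}` STPP family exists in `(ZMod 2 × ZMod 2 × ZMod 2 × ZMod 2) × ZMod n`.
Chain: icoset family ⇒ proper data with (T) + witness-(N) (`STPP222IcosetCriterion(Dual)`) ⇒ re-base at the lex-minimising
`(b*, u*)`, relabel by the sorting permutation (`STPP222IcosetRankFourCanon.canon_of_min`: the code list `D` is sorted and
canonical, so `classOk D` forces `vrefute (K+1) (zerosOf D) = true`) ⇒ the relabelled data still satisfies (T) + (N), hence has a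
standard bit solution rescuing every zero (`STPP222IcosetRankFourBits.exists_bsol_std`); every member of `zerosOf D` is such a zero
(`mem_zerosOf`, `isZero_codeList`) ⇒ `vrefute … = false` (`BSol.vrefute_sound`) — contradiction.  Also the cover semantics of
`allTuples` / `chunk` / `chunk3` used by the per-cell assembly files.
Seat pub-omega-kernel-l4 (gen 20), 2026-08-27.
-/

namespace Summit.MatrixMultiplication.OmegaCensus

open Literature.Computability.AlgebraicComplexity

namespace IcosetW

open IcosetH (getI snoc allN allN_true getI_eq_getD snoc_eq)

/-! ## `zerosOf` -/

/-- The fold inside `zerosOf`. -/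
noncomputable def zerosRec (n K : ℕ) (C : List ℕ) (m : ℕ) : List ℕ :=
  @Nat.rec (fun _ => List ℕ) [] (fun m acc =>
    frc (Nat.sub 511 m) fun z =>
      cnd (Nat.blt (zi z) K && Nat.blt (zj z) K && Nat.blt (zk z) K && !(Nat.beq (zi z) (zj z) && Nat.beq (zj z) (zk z)) &&
            isZero n C (zi z) (zj z) (zk z)) (z :: acc) acc) m

/-- `zerosOf = zerosRec … 512`. -/
theorem zerosOf_eq (n K : ℕ) (C : List ℕ) : zerosOf n K C = zerosRec n K C 512 := rfl

/-- Members of `zerosRec` satisfy the filter. -/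
theorem mem_zerosRec {n K : ℕ} {C : List ℕ} : ∀ (m : ℕ) {z : ℕ}, z ∈ zerosRec n K C m →
    zi z < K ∧ zj z < K ∧ zk z < K ∧ ¬ (zi z = zj z ∧ zj z = zk z) ∧ isZero n C (zi z) (zj z) (zk z) = true := by
  intro m
  induction m with
  | zero => intro z hz; exact absurd hz List.not_mem_nil
  | succ m ih =>
    intro z hz
    have e : zerosRec n K C (m + 1) = frc (Nat.sub 511 m) (fun z =>
        cnd (Nat.blt (zi z) K && Nat.blt (zj z) K && Nat.blt (zk z) K && !(Nat.beq (zi z) (zj z) && Nat.beq (zj z) (zk z)) &&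
          isZero n C (zi z) (zj z) (zk z)) (z :: zerosRec n K C m) (zerosRec n K C m)) := rfl
    rw [e, frc_eq, cnd_eq_ite] at hz
    split_ifs at hz with hc
    · rcases List.mem_cons.1 hz with rfl | hz
      · simp only [Bool.and_eq_true, Nat.blt_eq, Bool.not_eq_true', Bool.and_eq_false_iff] at hc
        obtain ⟨⟨⟨⟨h1, h2⟩, h3⟩, h4⟩, h5⟩ := hc
        refine ⟨h1, h2, h3, fun ⟨e1, e2⟩ => ?_, h5⟩
        rcases h4 with h4 | h4
        · exact Nat.ne_of_beq_eq_false h4 e1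
        · exact Nat.ne_of_beq_eq_false h4 e2
      · exact ih hz
    · exact ih hz

/-- **Members of `zerosOf`** have indices `< K`, are non-constant and satisfy the zero test. -/
theorem mem_zerosOf {n K : ℕ} {C : List ℕ} {z : ℕ} (hz : z ∈ zerosOf n K C) :
    zi z < K ∧ zj z < K ∧ zk z < K ∧ ¬ (zi z = zj z ∧ zj z = zk z) ∧ isZero n C (zi z) (zj z) (zk z) = true := by
  rw [zerosOf_eq] at hz; exact mem_zerosRec 512 hz

/-! ## The zero test on a code list of data -/

section Zero
variable {n : ℕ} [NeZero n] {K : ℕ}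

/-- The zero test on the code list of re-based scaled relabelled data detects exactly the vanishing of the `H`-word
`β_j − β_i + γ_k − γ_j` at the relabelled indices (unit scaling). -/
theorem isZero_codeList (β γ : Fin K → ZMod n) {b : ℕ} (hb : b < K) {u : ℕ} (hu : IsUnit (u : ZMod n)) (σ : Equiv.Perm (Fin K))
    {i j k : ℕ} (hi : i < K) (hj : j < K) (hk : k < K)
    (hz : isZero n (codeList β γ b (u : ZMod n) σ) i j k = true) :
    β ⟨permN σ j, permN_lt σ hj⟩ - β ⟨permN σ i, permN_lt σ hi⟩ +
      (γ ⟨permN σ k, permN_lt σ hk⟩ - γ ⟨permN σ j, permN_lt σ hj⟩) = 0 := by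
  unfold isZero codeList at hz
  rw [getI_ofFn _ hi, getI_ofFn _ hj, getI_ofFn _ hk] at hz
  simp only [] at hz
  rw [cfunN_eq β γ hb (permN_lt σ hi), cfunN_eq β γ hb (permN_lt σ hj), cfunN_eq β γ hb (permN_lt σ hk)] at hz
  set Xi := (u : ZMod n) * (β ⟨permN σ i, permN_lt σ hi⟩ - β ⟨b, hb⟩)
  set Xj := (u : ZMod n) * (β ⟨permN σ j, permN_lt σ hj⟩ - β ⟨b, hb⟩)
  set Yj := (u : ZMod n) * (γ ⟨permN σ j, permN_lt σ hj⟩ - γ ⟨b, hb⟩)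
  set Yk := (u : ZMod n) * (γ ⟨permN σ k, permN_lt σ hk⟩ - γ ⟨b, hb⟩)
  obtain ⟨dj, mj⟩ := code_div_mod Xj Yj
  obtain ⟨di, _⟩ := code_div_mod Xi ((u : ZMod n) * (γ ⟨permN σ i, permN_lt σ hi⟩ - γ ⟨b, hb⟩))
  obtain ⟨_, mk⟩ := code_div_mod ((u : ZMod n) * (β ⟨permN σ k, permN_lt σ hk⟩ - β ⟨b, hb⟩)) Yk
  have hz' : (Xj.val + Yk.val + (2 * n - (Xi.val + Yj.val))) % n = 0 := by
    have := Nat.eq_of_beq_eq_true hz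
    rw [← this]
    show _ = Nat.mod (Nat.add (Nat.add (Nat.div _ n) (Nat.mod _ n)) (Nat.sub (Nat.mul 2 n) (Nat.add (Nat.div _ n) (Nat.mod _ n)))) n
    rw [show Nat.div (code Xj Yj) n = code Xj Yj / n from rfl, dj, show Nat.mod (code _ Yk) n = code _ Yk % n from rfl, mk,
      show Nat.div (code Xi _) n = code Xi _ / n from rfl, di, show Nat.mod (code Xj Yj) n = code Xj Yj % n from rfl, mj]
    rfl
  have hle : Xi.val + Yj.val ≤ 2 * n := by have := ZMod.val_lt Xi; have := ZMod.val_lt Yj; omega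
  have hcast : ((Xj.val + Yk.val + (2 * n - (Xi.val + Yj.val)) : ℕ) : ZMod n) = Xj + Yk - (Xi + Yj) := by
    push_cast
    rw [Nat.cast_sub hle]
    push_cast
    simp [ZMod.natCast_val]
    ring
  have h0 : (Xj + Yk - (Xi + Yj) : ZMod n) = 0 := by
    rw [← hcast, ← ZMod.natCast_mod, hz', Nat.cast_zero]
  have h1 : (u : ZMod n) * (β ⟨permN σ j, permN_lt σ hj⟩ - β ⟨permN σ i, permN_lt σ hi⟩ +
      (γ ⟨permN σ k, permN_lt σ hk⟩ - γ ⟨permN σ j, permN_lt σ hj⟩)) = 0 := by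
    rw [← h0]; simp only [Xi, Xj, Yj, Yk]; ring
  exact (hu.mul_right_eq_zero).1 h1

end Zero

/-! ## Relabelled data -/

end IcosetW

namespace Icoset.Data

variable {V H : Type*} {K : ℕ}

/-- Relabel the triples of icoset data along `σ`. -/
def relabel (d : Icoset.Data V H K) (σ : Fin K → Fin K) : Icoset.Data V H K :=
  ⟨fun t => d.xA (σ t), fun t => d.xB (σ t), fun t => d.xC (σ t), fun t => d.sA (σ t), fun t => d.sB (σ t), fun t => d.sC (σ t),
    fun t => d.a (σ t), fun t => d.b (σ t), fun t => d.c (σ t)⟩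

/-- Slots of relabelled data. -/
theorem relabel_slots (d : Icoset.Data V H K) (σ : Fin K → Fin K) (i j k : Fin K) :
    (d.relabel σ).slots i j k = d.slots (σ i) (σ j) (σ k) := rfl

/-- Offsets of relabelled data. -/
theorem relabel_off [AddCommGroup V] [Module (ZMod 2) V] (d : Icoset.Data V H K) (σ : Fin K → Fin K) (i j k : Fin K) :
    (d.relabel σ).off i j k = d.off (σ i) (σ j) (σ k) := rfl

/-- `h` of relabelled data. -/
theorem relabel_h [AddCommGroup H] (d : Icoset.Data V H K) (σ : Fin K → Fin K) (i j k : Fin K) :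
    (d.relabel σ).h i j k = d.h (σ i) (σ j) (σ k) := rfl

/-- Independence of relabelled data. -/
theorem relabel_indep [AddCommGroup V] [Module (ZMod 2) V] (d : Icoset.Data V H K) (σ : Fin K → Fin K) (t : Fin K) :
    (d.relabel σ).Indep t ↔ d.Indep (σ t) := Iff.rfl

/-- `h` in terms of `β = b − a`, `γ = c − a`. -/
theorem h_eq_βγ [AddCommGroup H] (d : Icoset.Data V H K) (i j k : Fin K) :
    d.h i j k = (d.b j - d.a j) - (d.b i - d.a i) + ((d.c k - d.a k) - (d.c j - d.a j)) := by
  unfold Icoset.Data.h; abel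

end Icoset.Data

namespace IcosetW

open IcosetH (getI snoc allN allN_true getI_eq_getD snoc_eq)

/-! ## Cover semantics of the enumeration -/

/-- One step of `allTuples`. -/
theorem allTuples_succ (n K : ℕ) (U : List ℕ) (r lo : ℕ) (pre : List ℕ) :
    allTuples n K U (r + 1) lo pre = allN (Nat.mul n n) fun c => Nat.blt c lo || allTuples n K U r c (snoc pre c) := by
  show (allN (Nat.mul n n) fun c => Nat.blt c lo || frcL (snoc pre c) fun pre' => allTuples n K U r c pre') = _
  simp only [frcL_eq]

/-- `allTuples` at `r = 0`. -/
theorem allTuples_zero (n K : ℕ) (U : List ℕ) (lo : ℕ) (pre : List ℕ) : allTuples n K U 0 lo pre = classOk n K U pre := rfl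

/-- **Cover semantics of `allTuples`.** -/
theorem allTuples_sound {n K : ℕ} {U : List ℕ} : ∀ (r lo : ℕ) (pre ext : List ℕ), allTuples n K U r lo pre = true →
    ext.length = r → List.IsChain (· ≤ ·) (lo :: ext) → (∀ c ∈ ext, c < n * n) → classOk n K U (pre ++ ext) = true := by
  intro r
  induction r with
  | zero =>
    intro lo pre ext h hlen _ _
    rw [List.length_eq_zero_iff.1 hlen, List.append_nil]; exact h
  | succ r ih =>
    intro lo pre ext h hlen hch hlt
    obtain ⟨c, ext', rfl⟩ : ∃ c ext', ext = c :: ext' := by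
      cases ext with
      | nil => exact absurd hlen (by simp)
      | cons c ext' => exact ⟨c, ext', rfl⟩
    rw [List.isChain_cons_cons] at hch
    rw [allTuples_succ] at h
    have hc := allN_true h (show c < Nat.mul n n from hlt c List.mem_cons_self)
    simp only [Bool.or_eq_true, Nat.blt_eq] at hc
    rcases hc with hc | hc
    · exact absurd hc (Nat.not_lt.2 hch.1)
    · have := ih c (snoc pre c) ext' hc (by simpa using hlen) hch.2 (fun x hx => hlt x (List.mem_cons_of_mem _ hx))
      rwa [snoc_eq, List.append_assoc, List.singleton_append] at this

/-- **Cover semantics of `chunk`.** -/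
theorem chunk_sound {n K : ℕ} {U : List ℕ} {c1 lo hi : ℕ} (h : chunk n K U c1 lo hi = true) {c2 : ℕ} (h1 : lo ≤ c2)
    (h2 : c2 < hi) (h3 : c1 ≤ c2) : allTuples n K U (K - 3) c2 [0, c1, c2] = true := by
  have := allN_true h h2
  simp only [Bool.or_eq_true, Nat.blt_eq] at this
  rcases this with (h | h) | h
  · exact absurd h (Nat.not_lt.2 h1)
  · exact absurd h (Nat.not_lt.2 h3)
  · exact h

/-- **Cover semantics of `chunk3`.** -/
theorem chunk3_sound {n K : ℕ} {U : List ℕ} {c1 c2 lo hi : ℕ} (h : chunk3 n K U c1 c2 lo hi = true) {c3 : ℕ} (h1 : lo ≤ c3)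
    (h2 : c3 < hi) (h3 : c2 ≤ c3) : allTuples n K U (K - 4) c3 [0, c1, c2, c3] = true := by
  have := allN_true h h2
  simp only [Bool.or_eq_true, Nat.blt_eq] at this
  rcases this with (h | h) | h
  · exact absurd h (Nat.not_lt.2 h1)
  · exact absurd h (Nat.not_lt.2 h3)
  · exact h

/-! ## The reduction -/

/-- Codes of data are below `n²`. -/
theorem cfunN_lt {n : ℕ} [NeZero n] {K : ℕ} (β γ : Fin K → ZMod n) (b : ℕ) (u : ZMod n) (s : ℕ) : cfunN β γ b u s < n * n := by
  have hn : 0 < n := Nat.pos_of_ne_zero (NeZero.ne n)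
  unfold cfunN
  split_ifs
  · exact code_lt _ _
  · exact Nat.mul_pos hn hn
  · exact Nat.mul_pos hn hn

/-- `classOk` with a passed canonical test forces the search verdict. -/
theorem vrefute_of_classOk {n K : ℕ} {U : List ℕ} {C : List ℕ} (h : classOk n K U C = true) (hc : canon n K U C = true) :
    vrefute K (zerosOf n K C) = true := by
  unfold classOk at h; rw [hc, frcL_eq] at h; simpa using h

/-- **THE REDUCTION.**  `K + 1 ≤ 8` triples, `H = ZMod n`, `U` units closed under products; if the engine accepts every sorted code
class then there is no involution-coset `(2,2,2)^{K+1}` STPP family in `(ZMod 2)⁴ × ZMod n`. [cite: CohnKleinbergSzegedyUmans2005, Def. 5.1] -/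
theorem not_exists_r4_of_classOk {n : ℕ} [NeZero n] {K : ℕ} (hK8 : K + 1 ≤ 8) (U : List ℕ)
    (hUunit : ∀ u ∈ U, IsUnit ((u : ℕ) : ZMod n)) (hUmul : ∀ u ∈ U, ∀ u' ∈ U, u * u' % n ∈ U) (u₁ : ℕ) (hu₁ : u₁ ∈ U)
    (hall : ∀ C : List ℕ, C.length = K → C.Pairwise (· ≤ ·) → (∀ c ∈ C, c < n * n) → classOk n (K + 1) U (0 :: C) = true) :
    ¬ ∃ A B C : Fin (K + 1) → Finset (V4 × ZMod n), Icoset.IsIcosetFamily A B C ∧ IsSTPP A B C := by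
  intro hex
  obtain ⟨d, hd, hT, hN0⟩ := (Icoset.exists_isIcosetFamily_isSTPP_iff (V := V4) (H := ZMod n) (K + 1)).1 hex
  have hN : ∀ i j k : Fin (K + 1), ¬ (i = j ∧ j = k) → d.h i j k = 0 →
      ∃ φ : Module.Dual (ZMod 2) V4, (∀ r, φ (d.slots i j k r) = 0) ∧ φ (d.off i j k) = 1 :=
    fun i j k hne hh => (d.rescued_iff_exists_dual i j k).1 (hN0 i j k hne hh)
  -- H-data and the minimiser
  set β : Fin (K + 1) → ZMod n := fun t => d.b t - d.a t with hβ
  set γ : Fin (K + 1) → ZMod n := fun t => d.c t - d.a t with hγ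
  let val : ℕ × ℕ → List ℕ := fun p => rebased n (K + 1) (rawCodes β γ) p.1 p.2
  obtain ⟨hm1, -, hm3⟩ := argmin2_spec val (cands (K + 1) U) (0, u₁)
  set bu := argmin2 val (0, u₁) (cands (K + 1) U) with hbu
  have hbK : bu.1 < K + 1 ∧ bu.2 ∈ U := by
    rcases hm1 with h | h
    · rw [h]; exact ⟨Nat.succ_pos K, hu₁⟩
    · have := mem_cands.1 (show (bu.1, bu.2) ∈ cands (K + 1) U from h); exact this
  obtain ⟨hb, hu⟩ := hbK
  -- the canonical sorted code list
  obtain ⟨hD, hcan⟩ := canon_of_min β γ U hUmul hb hu hm3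
  set σ := sortPerm β γ ⟨bu.1, hb⟩ (bu.2 : ZMod n) with hσ
  set D := codeList β γ bu.1 (bu.2 : ZMod n) σ with hDdef
  have hsorted := (codeList_sortPerm β γ ⟨bu.1, hb⟩ (bu.2 : ZMod n)).2
  have htail := tail_codeList_eq_rebased β γ ⟨bu.1, hb⟩ bu.2
  -- the engine accepts the class …
  have hok : classOk n (K + 1) U D = true := by
    rw [hD, ← htail]
    refine hall _ (List.length_ofFn) hsorted fun c hc => ?_
    rw [List.mem_ofFn'] at hc
    obtain ⟨m, rfl⟩ := hc
    exact cfunN_lt _ _ _ _ _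
  have hv : vrefute (K + 1) (zerosOf n (K + 1) D) = true := vrefute_of_classOk hok hcan
  -- … but the relabelled data has a standard bit solution rescuing every listed zero
  let d' := d.relabel σ
  have hT' : ∀ t, d'.Indep t := fun t => (d.relabel_indep σ t).2 (hT (σ t))
  have hN' : ∀ i j k : Fin (K + 1), ¬ (i = j ∧ j = k) → d'.h i j k = 0 →
      ∃ φ : Module.Dual (ZMod 2) V4, (∀ r, φ (d'.slots i j k r) = 0) ∧ φ (d'.off i j k) = 1 := by
    intro i j k hne hh
    rw [Icoset.Data.relabel_h] at hh
    have hne' : ¬ (σ i = σ j ∧ σ j = σ k) := fun ⟨e1, e2⟩ => hne ⟨σ.injective e1, σ.injective e2⟩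
    exact hN _ _ _ hne' hh
  obtain ⟨S, h0, hF, hR⟩ := exists_bsol_std (Nat.succ_pos K) hK8 d' hT' hN'
  have hfalse := S.vrefute_sound hK8 (Nat.succ_pos K) hF h0 (TD := zerosOf n (K + 1) D) fun z hz => by
    obtain ⟨hi, hj, hk, hne, hzero⟩ := mem_zerosOf hz
    refine ⟨hi, hj, hk, ?_⟩
    have hzz := isZero_codeList β γ hb (hUunit _ hu) σ hi hj hk (by rw [hDdef] at hzero; exact hzero)
    have hh : d'.h ⟨zi z, hi⟩ ⟨zj z, hj⟩ ⟨zk z, hk⟩ = 0 := by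
      rw [Icoset.Data.relabel_h, Icoset.Data.h_eq_βγ]
      have e : ∀ (t : ℕ) (ht : t < K + 1), σ ⟨t, ht⟩ = ⟨permN σ t, permN_lt σ ht⟩ := fun t ht =>
        Fin.ext (by show (σ ⟨t, ht⟩).val = permN σ t; unfold permN; rw [dif_pos ht])
      rw [e _ hi, e _ hj, e _ hk]
      exact hzz
    have hz512 : z = 64 * zi z + 8 * zj z + zk z := by
      unfold zi zj zk; show z = 64 * (z / 64) + 8 * (z / 8 % 8) + z % 8; omega
    have := hR ⟨zi z, hi⟩ ⟨zj z, hj⟩ ⟨zk z, hk⟩ (fun ⟨e1, e2⟩ => hne ⟨congrArg Fin.val e1, congrArg Fin.val e2⟩) hh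
    rw [hz512]; exact this
  rw [hfalse] at hv
  exact Bool.false_ne_true hv

end IcosetW

end Summit.MatrixMultiplication.OmegaCensus
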